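import Literature.AlgebraicGeometry.HodgeTheory.SimpleOddPrimeDimensionHodgeClasses
import Literature.AlgebraicGeometry.HodgeTheory.GenericAbelianFivefoldPowersHodgeClasses
import Literature.AlgebraicGeometry.HodgeTheory.SimpleAbelianThreefoldPowersHodgeClasses
import HarnessLib

/-!
# Hodge classes on all powers of a SIMPLE complex abelian FIVEFOLD are generated by divisor classes
# (Tankeev–Ribet at the prime 5; Moonen–Zarhin 1999 §2 (2.6), Thm. (2.7), p. 715) — UNCONDITIONAL

Family `hodge`, layer `Literature/AlgebraicGeometry/HodgeTheory`. Research context: cell `pub-hodge-ring2` (HONEST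
FRAMING: research route conditional on HC_CM; not a corollary; Q11.4-sentence-2 already refuted in dim ≥ 3),
Literature lane gen 68, programme R44 (heir item H4a), CONCLUSION. UNCONDITIONAL; theorems only, no definition,
no named fact (D-0026), no `sorry`. The fivefold twin of `SimpleAbelianThreefoldPowersHodgeClasses`.

THE STATEMENT. For a SIMPLE complex abelian fivefold `X`: `B•(X^{N+1}) = D•(X^{N+1}) ⊗ ℂ` for every `N`
(`AbelianVariety.isDivisorGenerated_powSucc_of_isSimple_of_dim_five`), the Hodge conjecture for all powers and
their isogeny classes, and the `p = 5` slice of the tree's named fact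
`TankeevRibet1983_hodgeClasses_divisorial_powers_simplePrimeDimension` as a THEOREM (`tankeevRibet1983_of_dim_five`);
what remains of that fact is the non-CM case in prime dimension `≥ 7` (`tankeevRibet1983_iff_prime_ge_seven_nonCM`).
PROOF. Albert's four shapes in odd prime dimension (`SimpleOddPrimeDimensionHodgeClasses`:
`isDivisorGenerated_powSucc_of_isSimple_fivefold`, lit g66 R42/R43 — type I(5) by Ribet's Thm. 0, type IV with a
multiplicity `1` by Ribet's Thm. 3 for `(m,1)`, type IV(1) `(2,3)` by the classification-free Θ-subalgebra
theorem `UnitaryThetaCore.eq_top_two_three'`, type IV(5) = CM by Pohlmann) left exactly ONE pointwise hypothesis,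
the generic shape `End⁰(X) = ℚ`; it is the tree's `AbelianVariety.isDivisorGenerated_powSucc_of_fivefold_endRankOne`
(`GenericAbelianFivefoldPowersHodgeClasses`, lit g67–g68 R44: `Lie Hg = 𝔰𝔭₁₀` by the rank-ten Θ-subalgebra theorem
`SymplecticThetaTen.wordDerAt_eq_zero_of_skew`, then the invariant theory of `Sp`). MZ99 §2 (2.6) [corpus:
paper:arxiv-math_9901113 p0006 L2–L5]: «g = 5. As already stated above, Hg(X) = Sp_D(V,φ) for all simple abelian
5-folds. The point here is that 5 is a prime number, since in fact we have the following result, due to Tankeev.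
(See also Ribet's paper.)»; Thm. (2.7) [p0006 L9–L11]: «Let X be a simple complex abelian variety such that dim(X)
is a prime number. Then Hg(X) = Sp_D(V,φ) and B•(Xⁿ) = D•(Xⁿ) for every n ≥ 1»; p. 715 [p0005 L19–L22]: «For
g := dim(X) ≤ 3 and g = 5 we always find that Hg(X) = Sp_D(V,φ) … B•(Xⁿ) = D•(Xⁿ) for all n … In particular the
Hodge conjecture is true for all such Xⁿ». The clause `Hg(X) = Sp_D(V,φ)` is not rendered (as in the named fact).

## References

* [MoonenZarhin1999LowDim] B. Moonen, Yu. Zarhin, Math. Ann. 315 (1999), §2 (2.6), Thm. (2.7), p. 715.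
* [Tankeev1983] S. G. Tankeev, Cycles on simple abelian varieties of prime dimension, Math. USSR-Izv. 20 (1983).
* [Ribet1983] K. Ribet, Hodge classes on certain types of abelian varieties, Amer. J. Math. 105 (1983), Thms. 0–3.
* [Gordon1999HodgeAVSurvey] B. B. Gordon, A survey of the Hodge conjecture for abelian varieties, Thm. 6.3 and
  Corollary.
* [vanGeemen1994HodgeAV] B. van Geemen, LNM 1594 (1994), §2.4, Lemma 3.7, Thm. 4.6.
* [Deligne2000] P. Deligne, The Hodge conjecture (Clay problem description, 2000), §1.
-/

noncomputable section

open CategoryTheory Module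

namespace Literature.AlgebraicGeometry.HodgeTheory

open Literature.AlgebraicGeometry.Motives
open Literature.Barriers.HodgeConjecture (divisorClassesSpan)

section Main

variable {A : AbelianVariety ℂ}

/-- **Moonen–Zarhin 1999 (2.6) with Thm. (2.7) and p. 715, all powers — UNCONDITIONAL: `B•(A^{N+1}) = D•(A^{N+1}) ⊗ ℂ`
for every SIMPLE complex abelian fivefold `A`** (type I(1) `End⁰ = ℚ`: `AbelianVariety.isDivisorGenerated_powSucc_of_fivefold_endRankOne`,
`Hg = Sp₁₀`; the other three Albert shapes I(5), IV(1), IV(5): `isDivisorGenerated_powSucc_of_isSimple_fivefold`).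
«Let X be a simple complex abelian variety such that dim(X) is a prime number. Then … B•(Xⁿ) = D•(Xⁿ) for every
n ≥ 1» at the prime `5`. [cite: MoonenZarhin1999LowDim, §2 (2.6), Thm. (2.7) and p. 715] [cite: Tankeev1983, main theorem]
[cite: Ribet1983, Thms. 0–3] -/
theorem AbelianVariety.isDivisorGenerated_powSucc_of_isSimple_of_dim_five (A : AbelianVariety ℂ) (hA : A.IsSimple)
    (hdim : A.dim = 5) (N : ℕ) : IsDivisorGenerated (A.powSucc N) :=
  isDivisorGenerated_powSucc_of_isSimple_fivefold hA hdim
    (fun h1 N => AbelianVariety.isDivisorGenerated_powSucc_of_fivefold_endRankOne A h1 hdim N) N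

/-- `IsStablyNondegenerate A` (`B = D` on all powers) for every simple complex abelian fivefold.
[cite: MoonenZarhin1999LowDim, §2 condition (D), (2.6) and Thm. (2.7)] -/
theorem AbelianVariety.isStablyNondegenerate_of_isSimple_of_dim_five (A : AbelianVariety ℂ) (hA : A.IsSimple)
    (hdim : A.dim = 5) : IsStablyNondegenerate A :=
  fun N => AbelianVariety.isDivisorGenerated_powSucc_of_isSimple_of_dim_five A hA hdim N

/-- `A` itself: `B•(A) = D•(A) ⊗ ℂ` for a simple abelian fivefold. [cite: MoonenZarhin1999LowDim, §2 (2.6) and Thm. (2.7)] -/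
theorem AbelianVariety.isDivisorGenerated_of_isSimple_of_dim_five (A : AbelianVariety ℂ) (hA : A.IsSimple)
    (hdim : A.dim = 5) : IsDivisorGenerated A :=
  (AbelianVariety.isStablyNondegenerate_of_isSimple_of_dim_five A hA hdim).isDivisorGenerated

/-- **The Hodge conjecture for every power `A^{N+1}` of a simple complex abelian fivefold — UNCONDITIONAL.** MZ99
p. 715: «for g := dim(X) ≤ 3 and g = 5 we always find that Hg(X) = Sp_D(V,φ) … In particular the Hodge conjecture is
true for all such Xⁿ». [cite: MoonenZarhin1999LowDim, §2 p. 715, (2.6) and Thm. (2.7)] [cite: vanGeemen1994HodgeAV, Thm. 4.6 and §2.4]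
[cite: Deligne2000, §1] -/
theorem hodgeConjectureFor_powSucc_of_isSimple_of_dim_five (A : AbelianVariety ℂ) (hA : A.IsSimple)
    (hdim : A.dim = 5) (N : ℕ) : HodgeConjectureFor (A.powSucc N).dim (A.powSucc N).X :=
  hodgeConjectureFor_of_isDivisorGenerated _
    (AbelianVariety.isDivisorGenerated_powSucc_of_isSimple_of_dim_five A hA hdim N)

/-- The Hodge conjecture for a simple abelian fivefold itself. [cite: MoonenZarhin1999LowDim, §2 p. 715 and (2.6)] -/
theorem hodgeConjectureFor_of_isSimple_of_dim_five (A : AbelianVariety ℂ) (hA : A.IsSimple) (hdim : A.dim = 5) :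
    HodgeConjectureFor A.dim A.X :=
  hodgeConjectureFor_of_isDivisorGenerated _ (AbelianVariety.isDivisorGenerated_of_isSimple_of_dim_five A hA hdim)

/-- **The Hodge conjecture for every complex abelian variety isogenous to a power of a simple abelian fivefold.**
[cite: MoonenZarhin1999LowDim, §2 p. 715 and (2.6)] [cite: vanGeemen1994HodgeAV, Lemma 3.7] -/
theorem hodgeConjectureFor_of_isIsogenous_powSucc_of_isSimple_of_dim_five {A B : AbelianVariety ℂ}
    (hA : A.IsSimple) (hdim : A.dim = 5) {N : ℕ} (hB : B.IsIsogenous (A.powSucc N)) :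
    HodgeConjectureFor B.dim B.X :=
  HodgeConjectureFor.of_isIsogenous hB (hodgeConjectureFor_powSucc_of_isSimple_of_dim_five A hA hdim N)

/-- `B = D` for every complex abelian variety isogenous to a power of a simple abelian fivefold.
[cite: MoonenZarhin1999LowDim, §2 (2.6) and Thm. (2.7)] -/
theorem isDivisorGenerated_of_isIsogenous_powSucc_of_isSimple_of_dim_five {A B : AbelianVariety ℂ}
    (hA : A.IsSimple) (hdim : A.dim = 5) {N : ℕ} (hB : B.IsIsogenous (A.powSucc N)) : IsDivisorGenerated B :=
  (AbelianVariety.isDivisorGenerated_powSucc_of_isSimple_of_dim_five A hA hdim N).of_isIsogenous hB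

/-- The cycle part in the fact's consequence shape: every rational `(m,m)`-class on every power of a simple abelian
fivefold is algebraic. [cite: MoonenZarhin1999LowDim, §2 Thm. (2.7) and (2.6)] -/
theorem hodgeClasses_algebraic_powSucc_of_isSimple_of_dim_five (A : AbelianVariety ℂ) (hA : A.IsSimple)
    (hdim : A.dim = 5) (N m : ℕ) (c : complexBetti (A.powSucc N).X (2 * m)) (hc : IsRationalClass c)
    (hmm : IsOfHodgeType (A.powSucc N).dim (A.powSucc N).X (2 * m) m m c) :
    c ∈ algebraicClasses (A.powSucc N).X m :=
  (hodgeConjectureFor_powSucc_of_isSimple_of_dim_five A hA hdim N).2 m c hc hmm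

/-- **The `p = 5` slice of the tree's named fact `TankeevRibet1983_hodgeClasses_divisorial_powers_simplePrimeDimension`,
as a THEOREM**: for a SIMPLE complex abelian variety `X` of dimension `5`, every rational `(m,m)`-class on every power
`X^{N+1}` lies in `Dᵐ(X^{N+1}) ⊗ ℂ`. [cite: MoonenZarhin1999LowDim, §2 Thm. (2.7) and (2.6)]
[cite: Gordon1999HodgeAVSurvey, Thm. 6.3 and Corollary] [cite: Tankeev1983, main theorem] -/
theorem tankeevRibet1983_of_dim_five :
    ∀ (X : AbelianVariety ℂ), X.dim = 5 → X.IsSimple →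
      ∀ (N m : ℕ) (c : complexBetti (X.powSucc N).X (2 * m)), IsRationalClass c →
        IsOfHodgeType (X.powSucc N).dim (X.powSucc N).X (2 * m) m m c →
          c ∈ divisorClassesSpan (X.powSucc N).X (X.powSucc N).dim m :=
  fun X hX hs N m c hc hmm => AbelianVariety.isDivisorGenerated_powSucc_of_isSimple_of_dim_five X hs hX N m c hc hmm

/-- **What remains of the Tankeev–Ribet fact after this file: simple, NON-CM, of prime dimension `p ≥ 7`.**
(`p = 2`: `tankeevRibet1983_of_dim_two`; `p = 3`: `tankeevRibet1983_of_dim_three`; `p = 5`: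
`tankeevRibet1983_of_dim_five`; CM: Pohlmann.) [cite: MoonenZarhin1999LowDim, §2 Thm. (2.7)]
[cite: Gordon1999HodgeAVSurvey, Thm. 6.3 and Corollary] -/
theorem tankeevRibet1983_iff_prime_ge_seven_nonCM :
    TankeevRibet1983_hodgeClasses_divisorial_powers_simplePrimeDimension ↔
      ∀ (X : AbelianVariety ℂ) (p : ℕ), p.Prime → 7 ≤ p → X.dim = p → X.IsSimple →
        ¬ Literature.AlgebraicGeometry.Milne1999.IsOfCMType X →
        ∀ (N m : ℕ) (c : complexBetti (X.powSucc N).X (2 * m)), IsRationalClass c →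
          IsOfHodgeType (X.powSucc N).dim (X.powSucc N).X (2 * m) m m c →
            c ∈ divisorClassesSpan (X.powSucc N).X (X.powSucc N).dim m := by
  rw [tankeevRibet1983_iff_prime_ge_five_nonCM]
  refine ⟨fun h X p hp h7 hX hs hcm => h X p hp (by omega) hX hs hcm, fun h X p hp h5 hX hs hcm N m c hc hmm => ?_⟩
  by_cases hp5 : p = 5
  · subst hp5
    exact tankeevRibet1983_of_dim_five X hX hs N m c hc hmm
  · have h7 : 7 ≤ p := by
      rcases Nat.lt_or_ge p 7 with hlt | hge
      · interval_cases p <;> first | exact absurd hp (by decide) | omega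
      · exact hge
    exact h X p hp h7 hX hs hcm N m c hc hmm

/-- **The Tankeev–Ribet fact is EQUIVALENT to its two residual shapes in prime dimension `p ≥ 7`**: (S1) `End⁰ = ℚ`
(the symplectic shape `Hg = Sp_{2p}`, Ribet's Thm. 1 with `E = ℚ`) and (S2) `End⁰ = k` imaginary quadratic acting
with multiplicities `n', n'' ≥ 2` (the unitary shapes other than type one, Ribet's Thm. 3); refines the tree's
`tankeevRibet1983_iff_generic_and_unitary_shapes` (all odd primes) by the primes `3` and `5`, now theorems.
[cite: MoonenZarhin1999LowDim, §2 (2.4)–(2.7)] [cite: Gordon1999HodgeAVSurvey, Thm. 6.3 and Corollary] [cite: Ribet1983, Thms. 1 and 3] -/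
theorem tankeevRibet1983_iff_generic_and_unitary_shapes_prime_ge_seven :
    TankeevRibet1983_hodgeClasses_divisorial_powers_simplePrimeDimension ↔
      (∀ X : AbelianVariety ℂ, X.dim.Prime → 7 ≤ X.dim → X.IsSimple → Module.finrank ℚ X.endAlgebra = 1 →
        ∀ N : ℕ, IsDivisorGenerated (X.powSucc N)) ∧
      (∀ (X : AbelianVariety ℂ) (φ : X ⟶ X) (d : ℕ), X.dim.Prime → 7 ≤ X.dim → X.IsSimple → 0 < d →
        φ ≫ φ = -(d • 𝟙 X) → Module.finrank ℚ X.endAlgebra = 2 →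
        2 ≤ eigenMultiplicity X φ (Complex.I * (Real.sqrt d : ℂ)) →
        2 ≤ eigenMultiplicity X φ (-(Complex.I * (Real.sqrt d : ℂ))) → ∀ N : ℕ, IsDivisorGenerated (X.powSucc N)) := by
  refine ⟨fun h => ⟨fun X hp _ hs _ N m c hc hmm => h X X.dim hp rfl hs N m c hc hmm,
    fun X φ d hp _ hs _ _ _ _ _ N m c hc hmm => h X X.dim hp rfl hs N m c hc hmm⟩, fun ⟨hS1, hS2⟩ => ?_⟩
  rw [tankeevRibet1983_iff_prime_ge_seven_nonCM]
  intro X p hp h7 hX hs _ N m c hc hmm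
  have hp' : X.dim.Prime := hX ▸ hp
  have hodd : Odd X.dim := hX ▸ hp.odd_of_ne_two (by omega)
  exact isDivisorGenerated_powSucc_of_isSimple_of_prime_of_odd hs hp' hodd
    (fun he1 N => hS1 X hp' (by omega) hs he1 N)
    (fun φ d hd hφ he2 ha hb N => hS2 X φ d hp' (by omega) hs hd hφ he2 ha hb N) N m c hc hmm

end Main

end Literature.AlgebraicGeometry.HodgeTheory

end
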